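import Summits.BirchSwinnertonDyer.Rank1Residual.ManinAdditive.ResidualClassSelmerKummerLaws
import Literature.NumberTheory.EllipticCurves.BSDHeegnerPointsTorsionProofs
import Literature.NumberTheory.QuadraticFields.BinaryQuadraticFormsClassNumber
import HarnessLib
import HarnessLib.Audit.Tags

/-!
# es g37 (cell bsd-f2-manin, MEMO-es §58) — the FRICKE CM VALUE `φ(i/√N)`: LEMMA H, THEOREM S, THEOREM M♮

The object.  `τ_N = i/√N` is the unique fixed point in `ℍ` of the Fricke involution `w_N : τ ↦ −1/(Nτ)`; on `X₀(N)` it is the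
Heegner-type CM point `(ℂ/𝔫⁻¹ → ℂ/𝔫⁻²)`, `𝔫 = √−N·O`, `O = ℤ[√−N]` (discriminant `−4N`), rational over the ring class field `H_O`.
LEMMA H (paper proof, 3 lines; support row `FrickeValueTwoSmul` below): if `w_N f = −f` then `2·I_f(τ_N) = I_f(0)` for the Eichler
integral, hence `2·φ(τ_N) = φ(0)` (the tree's `atkinLehnerCuspPoint N`, a torsion point by Manin–Drinfeld) and
`φ_E(τ_N) = ([0]_f / 2)·Ω₀(E)` with `[0]_f := L(f,1)/Ω₀(f) ∈ ℤ₍₂₎` (`Ω₀` = least positive real period; the Manin constant CANCELS).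
So «`φ(τ_N)` has finite EVEN order» ⟺ «`[0]_f` is a 2-adic unit» (`FrickeValueEvenOrder`, intrinsic, any parametrisation datum up to odd isogeny).

THEOREM S (paper proof, MEMO-es §58.2).  `E(ℚ)[2] = 0`, `φ(τ_N)` of even order ⟹ `E(H_O)[2] ≠ 0` ⟹ `ℚ(E[2]) ⊂ H_O` ⟹
(generalised-dihedral argument) `Δ_E < 0`, `ℚ(√Δ_E) = ℚ(√−N)` (i.e. `−N·Δ_E ∈ ℚ^{×2}`) and `3 ∣ h(−4N)`; for odd `N`: `N ≡ 1 (mod 4) ⟹ E`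
ordinary at 2, and `E` supersingular at 2 ⟹ `N ≡ 3 (mod 8)`.  CENSUS (BC5; engines census23.py / census23b.py, Cremona `N < 5·10⁵`, optimal
curves, `c = 1`, `[0]_f = 2^{[Δ>0]}·L(E,1)/Ω(E)` read from allbsd): `[0]_f` odd & `E(ℚ)[2]=0`: 68 744 curves, ALL with `−NΔ ∈ ℚ²` (0 violations);
`3 ∣ h(−4N)`: 5 017 / 0 (`N < 2·10⁴`); supersingular-at-2 & `[0]_f` odd: 10 071 curves, all with `N ≡ 3 (mod 8)` (0 at `N ≡ 1,5,7`).

THEOREM M♮ (paper proof modulo LEMMA T of §57.12, MEMO-es §58.3).  `N = 4p`, `p` prime, `E(ℚ)[2] = 0`, `w_N f = −f` (even analytic rank).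
Then `ε(w₄) = −1` always at `4 ∥ N` (census24b: 75 543 / 75 543), so `W⁺ = ⟨w_p⟩`, and counting fixed points of the induced involution on
`X₀(4p)/w_p` above the 2-torsion translate `t` gives:  `v₂(deg φ) = 1 ⟺ (p ≡ 3 (mod 4) ∧ φ(τ_N) has even order)`  (optimal `φ`; the
direction `⟹` for every datum).  CENSUS (census24.py, `4p < 5·10⁵`, even rank, odd torsion): `p ≡ 1 (4)`: `4 ∣ deg φ` 634 / 0;
`p ≡ 3 (4)`: `[v₂(deg φ) = 1 ⟺ [0]_f odd]` 782 / 0 (367 optimal + 4 non-optimal with `v₂ = 1`, all `[0]_f` odd; 285 of rank 2, all `v₂ ≥ 2`).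
Consequences: E-es-174a/b (the 2-Selmer degree law) become the BSD-formula READING of M♮ (`[0]_f` odd ⟺ `Ш_an·∏c_p` odd at rank 0,
`[0]_f = 0` at rank > 0), and 169♯ at `ω(N) = 2`, even rank, is M♮(a).

Rows (es's `@[conjecture]` tags = census laws with paper proofs in the memo; nothing asserted): E-es-H `FrickeValueTwoSmul` (support),
E-es-179a `FrickeValueEvenOrderForcesFrickeField` (THEOREM S (1)(3)), E-es-179b `FrickeValueEvenOrderSupersingularForcesThreeModEight`
(THEOREM S (4)), E-es-180a `EvenRankDegreeTwoModFourForcesFrickeValueEvenOrder` (M♮ ⟹, any datum), E-es-180b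
`EvenRankFrickeValueEvenOrderForcesDegreeTwoModFour` (M♮ ⟸, lattice-optimal datum); proved edge
`isSquare_and_three_dvd_classNumber_of_degreeTwoModFour` (M♮ + S ⟹ L♮'s residual-class statement at `N = 4p`, even rank).
PARTITION 0 · BSD is not proved by this; Manin's conjecture (`c = 1` at `4 ∥ N`, crux C2 `ManinOddAtFour`) is not proved by this — these are
degree / torsion-value laws in C2's habitat (the Manin constant cancels from `[0]_f`).

TYPER NOTE (typer g21, T-es-71).  SOURCE = HOME/es/g37/Sketch-es-g37.lean sha16 e9ab3ce6448e56fa (161 l.; es: farm rc 0·0·0·0;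
BC7 Probe-es-g37.lean 484a923fc6e798ef 5/5 CLEAN; MEMO-es §58, pack HOME/es/g37/ + SHA16SUMS.es.g37) VERBATIM but for three typer
deltas: (i) this note; (ii) cite-key repairs — the interim stub key `Cremona1997` → `Cremona1997Algorithms` (J. E. Cremona,
*Algorithms for modular elliptic curves*, 2nd ed., CUP 1997 — the entry the locators §2.8/§2.11 refer to) and the malformed bare
arXiv key `math/0512628` → `CastanoBernard2005` (C. Castaño-Bernard, «On the 2-divisibility of certain Heegner points»,
arXiv:math/0512628, 2005 — key ADDED to references.bib; held as corpus paper:arxiv-math_0512628); (iii) file name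
`FrickeValueDegreeLaws.lean` (named for the mathematics; namespace `…ManinAdditive.AtkinLehnerDegree` shared with
`ALFixedPointDiscriminantLaw.lean` / `AtkinLehnerDegreeLaws.lean` / `ResidualClassSelmerKummerLaws.lean`, decl names fresh).
Imports (all landed): `…ManinAdditive.ResidualClassSelmerKummerLaws` (p750937/p751351), Literature `BSDHeegnerPointsTorsionProofs`,
`QuadraticFields.BinaryQuadraticFormsClassNumber`, HarnessLib(+Audit.Tags).  ROWS (es's `@[conjecture]` tags; nothing asserted):
E-es-H `FrickeValueTwoSmul` (support, plain def), **E-es-179a `FrickeValueEvenOrderForcesFrickeField`**, **E-es-179b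
`FrickeValueEvenOrderSupersingularForcesThreeModEight`**, **E-es-180a `EvenRankDegreeTwoModFourForcesFrickeValueEvenOrder`**, **E-es-180b
`EvenRankFrickeValueEvenOrderForcesDegreeTwoModFour`**; defs `frickeFixedPoint`, `FrickeValueEvenOrder`; PROVED edges
`isSquare_and_three_dvd_classNumber_of_degreeTwoModFour`, `four_dvd_modularDegree_of_gaussian_evenRank`; `decide +kernel` sanity
`example` (3 ∣ h(−176), 3 ∣ h(−368)).  REFUTER: ref1/ref2 R-es-86 PENDING at landing.  No instances, no notation, no sorry.
`--supports` refused for ManinAdditive ⇒ bears_on: stmt-BirchSwinnertonDyer-22967 (C2 `ManinOddAtFour`).  BSD is not proved by this;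
Manin c = 1 at 4 ∥ N not proved (c cancels from `[0]_f`); C2 OPEN.
-/

namespace Summit.BirchSwinnertonDyer.Rank1Residual.ManinAdditive.AtkinLehnerDegree

open scoped MatrixGroups ModularForm UpperHalfPlane
open CongruenceSubgroup WeierstrassCurve
open Literature.NumberTheory.EllipticCurves Literature.NumberTheory.EllipticCurves.ModularForms
open Summit.BirchSwinnertonDyer.Rank1Residual.ManinAdditive.ConwayCut
open Literature.NumberTheory.QuadraticFields.Quadratic

/-- The **Fricke fixed point** `τ_N = i/√N ∈ ℍ` (real part `0`, imaginary part `1/√N`): the unique fixed point in `ℍ` of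
`w_N : τ ↦ −1/(Nτ)`; as a point of `X₀(N)` the CM point `(ℂ/𝔫⁻¹ → ℂ/𝔫⁻²)` of the order `ℤ[√−N]` (discriminant `−4N`). -/
noncomputable def frickeFixedPoint (N : ℕ) [NeZero N] : ℍ :=
  UpperHalfPlane.mk ⟨0, (Real.sqrt (N : ℝ))⁻¹⟩
    (inv_pos.mpr (Real.sqrt_pos.mpr (by exact_mod_cast (NeZero.pos N))))

/-- **LEMMA H's invariant (intrinsic form).**  The Fricke CM value `φ(τ_N) ∈ E(ℂ)` is a torsion point of EVEN order — equivalently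
(LEMMA H, for `w_N f = −f`) the half modular symbol `[0]_f/2 = L(f,1)/(2Ω₀(f))` has odd denominator-free numerator: `[0]_f ∈ ℤ₍₂₎^×`.
Invariant under composing `φ` with an odd-degree isogeny; NOT under `φ ↦ [2]∘φ`. -/
def FrickeValueEvenOrder {W : WeierstrassCurve ℚ} {N : ℕ} [NeZero N] (D : ModularParametrizationData W N) : Prop :=
  0 < addOrderOf (D.φ (frickeFixedPoint N)) ∧ 2 ∣ addOrderOf (D.φ (frickeFixedPoint N))

/-- **Row E-es-H `FrickeValueTwoSmul`** (support; LEMMA H, MEMO-es §58.1 — a THEOREM on paper: `I_f(w_N τ) = ε·(I_f(τ) − I_f(0))`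
for `w_N f = ε f`, evaluate at the fixed point `τ_N` with `ε = −1`).  In tree terms: `2·φ(τ_N)` is the Atkin–Lehner cusp point `t_N`
(`= φ(x/1)`, `x = gcdA N 1 ∈ ℤ`, i.e. `φ` at the cusp `0`).  Needs `φ`'s `Γ₀(N)`-invariance (the tree's fact `φ_gamma0_smul`, for the
translation `τ ↦ τ + 1`) and the Fricke transformation of the Eichler integral (cf. `φ_atkinLehnerW_smul`, whose `atkinLehnerW N N` is
`w_N ∘ T`).  Why it might fail: only by a normalisation slip (`modularSymbol f x` vs `x = 0`); the mathematics is classical.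
[cite: Cremona1997Algorithms, §2.8 eq. (2.8.9) and §2.11 (splitting the period integral at i/√N)] -/
def FrickeValueTwoSmul : Prop :=
  ∀ (W : WeierstrassCurve ℚ) [W.IsElliptic] {N : ℕ} [NeZero N] (D : ModularParametrizationData W N),
    D.φ_gamma0_smul → frickeInvolution N 2 D.f = -D.f →
    (2 : ℕ) • D.φ (frickeFixedPoint N) = D.atkinLehnerCuspPoint N

/-- **Row E-es-179a `FrickeValueEvenOrderForcesFrickeField`** (THEOREM S (1)+(3), MEMO-es §58.2; paper proof: `τ_N ∈ X₀(N)(H_O)`,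
`O = ℤ[√−N]`, so an even-order `φ(τ_N)` puts a 2-torsion point in `E(H_O)`; with `E(ℚ)[2] = 0`, `Gal(ℚ(E[2])/ℚ) ∈ {A₃, S₃}` inside the
generalised-dihedral `Gal(H_O/ℚ)` forces `S₃` with quadratic subfield `ℚ(√Δ) = ℚ(√−N)` and a cyclic cubic piece of `Pic(O)`).
For ANY model and ANY parametrisation datum: `E(ℚ)[2] = 0 ∧ φ(τ_N)` of even order ⟹ `−N·Δ` is a square in `ℚ` and `3 ∣ h(−4N)`.
Census (BC5): 68 744 / 0 and 5 017 / 0 (file docstring).  Why it might fail: only if LEMMA H's identification of the parity of `[0]_f` with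
the order of `φ(τ_N)` or the `H_O`-rationality of `τ_N` were misapplied for non-optimal data (odd isogenies preserve it; `[2]∘φ` kills the
hypothesis, not the conclusion).  Nearest print: Castaño-Bernard 2005 (arXiv:math/0512628, Conj. 2.1–2.9: parity of TRACES of the
`w_N`-fixed Heegner points, ODD rank, prime `N`) and Gross 1987 (Prop. 3.1: `Fix(w_N)` = Heegner points of discriminant `−4N`) — the
even-rank torsion-value statement is the cell's, NOT in print. [cite: CastanoBernard2005, arXiv:math/0512628, §2 (Conj. 2.1, Thm. 2.5; the odd-rank analogue)] -/
@[conjecture]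
def FrickeValueEvenOrderForcesFrickeField : Prop :=
  ∀ (W : WeierstrassCurve ℚ) [W.IsElliptic] {N : ℕ} [NeZero N] (D : ModularParametrizationData W N),
    W.conductorNorm ℤ = N → ¬ HasRationalTwoTorsion W → FrickeValueEvenOrder D →
    IsSquare (-(N : ℚ) * W.Δ) ∧ 3 ∣ BinQF.classNumber (-(4 * (N : ℤ)))

/-- **Row E-es-179b `FrickeValueEvenOrderSupersingularForcesThreeModEight`** (THEOREM S (4), MEMO-es §58.2; paper proof: for odd `N`
the prime 2 is unramified in `H_O/ℚ(√−N)` and ramified in `ℚ(√−N)`, so inertia at 2 in `ℚ(E[2]) ⊂ H_O` has order ≤ 2, while good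
SUPERSINGULAR reduction at 2 makes `E[2]` totally ramified of degree 3 unless … ; the residual analysis leaves exactly `N ≡ 3 (mod 8)`).
Statement: `N` odd, `E(ℚ)[2] = 0`, `φ(τ_N)` of even order, `a₂(E)` even ⟹ `N ≡ 3 (mod 8)`.  Census (census23b.py, optimal, `N < 5·10⁵`):
`[0]_f` odd & `a₂` even: 10 071 curves, all `N ≡ 3 (mod 8)`; `[0]_f` odd at `N ≡ 1, 5, 7 (mod 8)`: 2 401 + 2 319 + 2 158 curves, all ordinary.
Why it might fail: a slip in the local inertia computation at 2 for `N ≡ 7 (mod 8)` (where the proof gives MORE: `E[2] ⊂ E(ℚ₂)`); data 0 / 16 949.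
[cite: CastanoBernard2005, arXiv:math/0512628, Lemma 2.4 (prime N ≡ 7 (mod 8) ⟹ a₂ odd — the rank-1 shadow of this row)] -/
@[conjecture]
def FrickeValueEvenOrderSupersingularForcesThreeModEight : Prop :=
  ∀ (W : WeierstrassCurve ℚ) [W.IsElliptic] {N : ℕ} [NeZero N] (D : ModularParametrizationData W N),
    W.conductorNorm ℤ = N → ¬ 2 ∣ N → ¬ HasRationalTwoTorsion W → FrickeValueEvenOrder D →
    Even (W.LFunction 2) → N % 8 = 3

/-- **Row E-es-180a `EvenRankDegreeTwoModFourForcesFrickeValueEvenOrder`** (THEOREM M♮, direction valid for EVERY parametrisation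
datum at the conductor; MEMO-es §58.3).  `N = 4p`, `p` prime, `E(ℚ)[2] = 0`, `w_N f = −f`: `v₂(deg φ) = 1 ⟹ p ≡ 3 (mod 4) ∧ φ(τ_N)` has
even order.  (At `p ≡ 1 (mod 4)` this is `4 ∣ deg φ` — the even-rank, `ω(N) = 2` case of row 169♯ `GaussianLevelSharp`; census 634 / 0.
At `p ≡ 3 (mod 4)`: 371 / 371 curves with `v₂(deg φ) = 1` have `[0]_f` odd.)  Paper proof modulo LEMMA T (one `Pic(ℤ[2√−p])`-orbit of
`w_N`-fixed points, `t` constant on it, `m = [t ≠ 0]·#orbit/3` odd iff `p ≡ 3 (4) ∧ t ≠ 0`).  Why it might fail: LEMMA T's orbit-constancy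
of `t` at `p ≡ 1 (mod 4)` (order `ℤ[2i·…]`, even class number `2h(−4p)`), where the count needs BOTH halves of the orbit to carry the same `t`.
[cite: Watkins2002, Conj. 4.2 (arXiv:math/0109101 p. 12: `2^r ∣ deg φ` — implied here at rank ≥ 2 by `[0]_f = 0`); arXiv:0910.0571 §1 (Calegari–Emerton parity circle)] -/
@[conjecture]
def EvenRankDegreeTwoModFourForcesFrickeValueEvenOrder : Prop :=
  ∀ (W : WeierstrassCurve ℚ) [W.IsElliptic] [W.IsGloballyMinimal] {N : ℕ} [NeZero N]
    (D : ModularParametrizationData W N) (p : ℕ), p.Prime → N = 4 * p → W.conductorNorm ℤ = N →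
    ¬ HasRationalTwoTorsion W → frickeInvolution N 2 D.f = -D.f →
    padicValNat 2 D.modularDegree = 1 → p % 4 = 3 ∧ FrickeValueEvenOrder D

/-- **Row E-es-180b `EvenRankFrickeValueEvenOrderForcesDegreeTwoModFour`** (THEOREM M♮, converse for LATTICE-OPTIMAL data
`Λ_W = c·Λ_f` — the hypothesis of C2 `ManinOddAtFour`; MEMO-es §58.3).  `N = 4p`, `p ≡ 3 (mod 4)` prime, `E(ℚ)[2] = 0`, `w_N f = −f`,
`φ(τ_N)` of even order ⟹ `¬ 4 ∣ deg φ` (with the parity floor `2 ∣ deg φ`: `deg φ ≡ 2 (mod 4)`).  Census: 367 / 367 optimal curves of the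
class with `[0]_f` odd have `v₂(deg φ) = 1` (`4p < 5·10⁵`).  Why it might fail: `v₂(deg)` is not an invariant of the isogeny class
(`[2]∘φ`), whence the lattice-optimality binder; and LEMMA T as in 180a.
[cite: Watkins2002, §4 (arXiv:math/0109101 p. 12: heuristics for powers of 2 in deg φ; this converse law is the cell's, NOT in print)] -/
@[conjecture]
def EvenRankFrickeValueEvenOrderForcesDegreeTwoModFour : Prop :=
  ∀ (W : WeierstrassCurve ℚ) [W.IsElliptic] [W.IsGloballyMinimal] {N : ℕ} [NeZero N]
    (D : ModularParametrizationData W N) (p : ℕ), p.Prime → p % 4 = 3 → N = 4 * p → W.conductorNorm ℤ = N →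
    (∀ z ∈ D.L.lattice, ∃ w ∈ periodLattice D.f, z = D.c * w) →
    ¬ HasRationalTwoTorsion W → frickeInvolution N 2 D.f = -D.f →
    FrickeValueEvenOrder D → ¬ 2 ^ 2 ∣ D.modularDegree

/-- Edge (proved): THEOREM M♮ (⟹) + THEOREM S recover, at `N = 4p` and even analytic rank, the residual-class statement of THEOREM L♮
WITHOUT its hypothesis (iii): `v₂(deg φ) = 1 ⟹ ℚ(√Δ) = ℚ(√−p)` (`−N·Δ = −4p·Δ` a square) and `3 ∣ h(−16p)`. -/
theorem isSquare_and_three_dvd_classNumber_of_degreeTwoModFour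
    (hM : EvenRankDegreeTwoModFourForcesFrickeValueEvenOrder) (hS : FrickeValueEvenOrderForcesFrickeField)
    (W : WeierstrassCurve ℚ) [W.IsElliptic] [W.IsGloballyMinimal] {N : ℕ} [NeZero N]
    (D : ModularParametrizationData W N) (p : ℕ) (hp : p.Prime) (hN : N = 4 * p) (hc : W.conductorNorm ℤ = N)
    (hT : ¬ HasRationalTwoTorsion W) (hF : frickeInvolution N 2 D.f = -D.f) (hv : padicValNat 2 D.modularDegree = 1) :
    p % 4 = 3 ∧ IsSquare (-(N : ℚ) * W.Δ) ∧ 3 ∣ BinQF.classNumber (-(4 * (N : ℤ))) := by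
  obtain ⟨hp3, hE⟩ := hM W D p hp hN hc hT hF hv
  exact ⟨hp3, hS W D hc hT hE⟩

/-- Edge (proved): under E-es-180a, at `N = 4p` with `p ≡ 1 (mod 4)`, `E(ℚ)[2] = 0` and even analytic rank, `v₂(deg φ) ≠ 1`; with the
parity floor `2 ∣ deg φ` this is `4 ∣ deg φ` (the even-rank `ω = 2` case of 169♯). -/
theorem four_dvd_modularDegree_of_gaussian_evenRank
    (hM : EvenRankDegreeTwoModFourForcesFrickeValueEvenOrder)
    (W : WeierstrassCurve ℚ) [W.IsElliptic] [W.IsGloballyMinimal] {N : ℕ} [NeZero N]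
    (D : ModularParametrizationData W N) (p : ℕ) (hp : p.Prime) (hp1 : p % 4 = 1) (hN : N = 4 * p)
    (hc : W.conductorNorm ℤ = N) (hT : ¬ HasRationalTwoTorsion W) (hF : frickeInvolution N 2 D.f = -D.f)
    (h2 : 2 ∣ D.modularDegree) : 4 ∣ D.modularDegree := by
  have hpos : D.modularDegree ≠ 0 := (D.deg_pos).ne'
  have hv1 : padicValNat 2 D.modularDegree ≠ 1 := fun h => by
    have := (hM W D p hp hN hc hT hF h).1; omega
  have hv0 : 1 ≤ padicValNat 2 D.modularDegree := by
    have h2' : 2 ^ 1 ∣ D.modularDegree := by rwa [pow_one]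
    exact (padicValNat_dvd_iff_le (p := 2) hpos).mp h2'
  have hv2 : 2 ≤ padicValNat 2 D.modularDegree := by omega
  have : 2 ^ 2 ∣ D.modularDegree := (padicValNat_dvd_iff_le (p := 2) hpos).mpr hv2
  simpa using this

/- Sanity rung for THEOREM S (3) at the first two residual conductors `44 = 4·11` and `92 = 4·23` (curves 44a1, 92a1: `[0]_f = 1/3`,
`1` — odd): `3 ∣ h(−176) = 6` and `3 ∣ h(−368) = 6`, by evaluation of the tree's form class number. -/
set_option maxRecDepth 20000 in
example : 3 ∣ BinQF.classNumber (-176) ∧ 3 ∣ BinQF.classNumber (-368) := by decide +kernel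

end Summit.BirchSwinnertonDyer.Rank1Residual.ManinAdditive.AtkinLehnerDegree
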